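import Mathlib.LinearAlgebra.Lagrange
import Literature.Combinatorics.Optimization.TracialDesigns
import HarnessLib

/-!
# Cell pnp-psdrank, route `ChebyshevTracialDesign`: the level profile of a design with `≤ D + 1` nodes is interpolated
# exactly — stub ATT of the crux skeleton is free there, and the crux is the virtual-level inequality

For an exact extrapolation design `(C, w)` of degree `D` (`IsExactDesign n t T D B C w`:
`Σ_c w_c p(c) = −p(0)` for every real polynomial of degree `≤ D`):
* every such design has at least `D + 1` nodes (`succ_le_card_of_isExactDesign`);
* if it has at most (hence exactly) `D + 1` nodes — the case of the route's Chebyshev design, whose nodes are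
  `3 + 4sj²`, `0 ≤ j ≤ D` — then for EVERY profile `Φ : ℕ → ℝ` the design value `Σ_c w_c Φ(c)` equals `−p_Φ(0)` for the
  Lagrange interpolant `p_Φ` of `Φ` on `C` (degree `≤ D`; `design_sum_eq_neg_interpolate_eval_zero`);
* the tracial value of a psd rectangle is `r · Σ_c w_c Φ(c)` with `Φ` its level profile (`value_div_eq_sum_levelProfile`);
* consequently planner p1's skeleton stub ATT ("profile attenuation": the profile is `n^{-D/4}`-close on the nodes to a
  polynomial of degree `≤ D` and the value is bounded by the design applied to it; HOME/pnp-psdrank-p1/route-B/bc/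
  TracialDecayExp20_birth.lean) holds with error `0` for all designs with `C.card ≤ dq n + 1`
  (`profileAttenuation_of_card_le`), with NO hypothesis on the rectangle — so for this design class the crux
  `TracialDecayExp20` is exactly its second stub VIRT (virtual-level positivity `p_Φ(0) ≥ −exp(−a·dq n)`).
WHAT THIS IS NOT: no progress on VIRT; nothing for designs with more than `D + 1` nodes (there ATT is a genuine
harmonic-analysis statement). Supports crux stmt-PneNP-19878 (structure of its skeleton).
-/

set_option linter.dupNamespace false -- `Summit.PneNP.PneNP.…`: summit = sub-problem (D-0017)

noncomputable section

open scoped Classical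

namespace Summit.PneNP.PneNP.Theorems.ChebyshevTracialDesignProfileInterpolation

open Finset Matrix Polynomial Literature.Barriers.PneNP Literature.Combinatorics.Optimization

variable {n : ℕ}

/-! ### §1 The value of a multilevel weight is the design applied to the level profile -/

/-- `Σ_U Σ_M levelWeight(U,M) · F(U,M) = Σ_{c ∈ C} (w_c / |Q_c|) Σ_{(U,M) ∈ Q_c} F(U,M)`. -/
theorem sum_levelWeight_mul (t : ℕ) (C : Finset ℕ) (w : ℕ → ℝ) (F : OddSet n → PMatch n → ℝ) :
    ∑ U, ∑ M, levelWeight n t C w U M * F U M =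
      ∑ c ∈ C, w c / ((Qset n t c).card : ℝ) * ∑ q ∈ Qset n t c, F q.1 q.2 := by
  calc ∑ U, ∑ M, levelWeight n t C w U M * F U M
      = ∑ U, ∑ M, ∑ c ∈ C, (if (U, M) ∈ Qset n t c then w c / ((Qset n t c).card : ℝ) * F U M else 0) := by
        refine sum_congr rfl fun U _ => sum_congr rfl fun M _ => ?_
        rw [levelWeight, sum_mul]
        exact sum_congr rfl fun c _ => by split_ifs <;> simp
    _ = ∑ U, ∑ c ∈ C, ∑ M, (if (U, M) ∈ Qset n t c then w c / ((Qset n t c).card : ℝ) * F U M else 0) :=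
        sum_congr rfl fun U _ => sum_comm
    _ = ∑ c ∈ C, ∑ U, ∑ M, (if (U, M) ∈ Qset n t c then w c / ((Qset n t c).card : ℝ) * F U M else 0) :=
        sum_comm
    _ = ∑ c ∈ C, w c / ((Qset n t c).card : ℝ) * ∑ q ∈ Qset n t c, F q.1 q.2 := by
        refine sum_congr rfl fun c _ => ?_
        rw [sum_sum_ite_mem (Qset n t c) fun U M => w c / ((Qset n t c).card : ℝ) * F U M, mul_sum]

/-- **Value identity**: `(1/r) Σ_U Σ_M levelWeight · tr(X_U Y_M) = Σ_{c ∈ C} w_c · Φ(c)` with `Φ` the level profile. -/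
theorem value_div_eq_sum_levelProfile {t r : ℕ} (hr : 0 < r) (C : Finset ℕ) (w : ℕ → ℝ)
    (X : OddSet n → Matrix (Fin r) (Fin r) ℝ) (Y : PMatch n → Matrix (Fin r) (Fin r) ℝ) :
    (∑ U, ∑ M, levelWeight n t C w U M * (X U * Y M).trace) / r =
      ∑ c ∈ C, w c * levelProfile n t r X Y c := by
  have hr' : (r : ℝ) ≠ 0 := by exact_mod_cast hr.ne'
  rw [sum_levelWeight_mul, sum_div]
  refine sum_congr rfl fun c _ => ?_
  rw [levelProfile]
  by_cases hq : ((Qset n t c).card : ℝ) = 0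
  · rw [hq]; simp
  · field_simp

/-! ### §2 Designs of degree `D`: at least `D + 1` nodes; with `D + 1` nodes the value is an extrapolation -/

/-- An exact design of degree `D` has at least `D + 1` nodes (else the nodal polynomial of `C`, of degree `≤ D` and
nonzero at `0` since all nodes are `≥ 3`, violates exactness). -/
theorem succ_le_card_of_isExactDesign {t T D : ℕ} {B : ℝ} {C : Finset ℕ} {w : ℕ → ℝ}
    (h : IsExactDesign n t T D B C w) : D + 1 ≤ C.card := by
  by_contra hlt
  push Not at hlt
  have hdeg : (Lagrange.nodal C (fun c : ℕ => (c : ℝ))).natDegree ≤ D := by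
    rw [Lagrange.natDegree_nodal]; omega
  have hex := h.2.2.2.2.2.1 _ hdeg
  have hzero : ∑ c ∈ C, w c * (Lagrange.nodal C (fun c : ℕ => (c : ℝ))).eval (c : ℝ) = 0 :=
    sum_eq_zero fun c hc => by rw [Lagrange.eval_nodal_at_node hc, mul_zero]
  have hne : (Lagrange.nodal C (fun c : ℕ => (c : ℝ))).eval 0 ≠ 0 := by
    rw [Lagrange.eval_nodal]
    refine prod_ne_zero_iff.2 fun c hc => ?_
    have h3 : (3 : ℝ) ≤ c := by exact_mod_cast (h.2.2.2.1 c hc).2.1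
    linarith
  rw [hzero] at hex
  exact hne (by linarith)

/-- The interpolant agrees with the profile on the nodes. -/
theorem eval_interpolate_node {C : Finset ℕ} (Φ : ℕ → ℝ) {c : ℕ} (hc : c ∈ C) :
    (Lagrange.interpolate C (fun c : ℕ => (c : ℝ)) Φ).eval (c : ℝ) = Φ c := by
  exact Lagrange.eval_interpolate_at_node _ Nat.cast_injective.injOn hc

/-- The interpolant has degree `< |C|`, so `≤ D` when `|C| ≤ D + 1`. -/
theorem natDegree_interpolate_le_of_card {C : Finset ℕ} (Φ : ℕ → ℝ) {D : ℕ} (hC : C.card ≤ D + 1) :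
    (Lagrange.interpolate C (fun c : ℕ => (c : ℝ)) Φ).natDegree ≤ D := by
  have hdeg := Lagrange.degree_interpolate_lt Φ (Nat.cast_injective.injOn (s := (C : Set ℕ)) (f := fun c : ℕ => (c : ℝ)))
  by_cases hP : Lagrange.interpolate C (fun c : ℕ => (c : ℝ)) Φ = 0
  · rw [hP, natDegree_zero]; exact Nat.zero_le _
  · have := (natDegree_lt_iff_degree_lt hP).2 hdeg
    omega

/-- **With `≤ D + 1` nodes every profile is extrapolated**: `Σ_c w_c Φ(c) = −p_Φ(0)`. -/
theorem design_sum_eq_neg_interpolate_eval_zero {t T D : ℕ} {B : ℝ} {C : Finset ℕ} {w : ℕ → ℝ}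
    (h : IsExactDesign n t T D B C w) (hC : C.card ≤ D + 1) (Φ : ℕ → ℝ) :
    ∑ c ∈ C, w c * Φ c = -(Lagrange.interpolate C (fun c : ℕ => (c : ℝ)) Φ).eval 0 := by
  rw [← h.2.2.2.2.2.1 _ (natDegree_interpolate_le_of_card Φ hC)]
  exact sum_congr rfl fun c hc => by rw [eval_interpolate_node Φ hc]

/-! ### §3 Stub ATT of the crux skeleton, for designs with `≤ dq n + 1` nodes -/

/-- **Stub ATT (profile attenuation) holds with error `0` for designs with at most `dq n + 1` nodes** — in particular
for the route's Chebyshev design (`dq n + 1` nodes `3 + 4sj²`): the interpolant of the level profile has degree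
`≤ dq n`, agrees with the profile on the nodes, and the normalised tracial value equals `Σ_c w_c p(c)`. Signature =
planner p1's `stub_profileAttenuation` (TracialDecayExp20_birth.lean) with the extra hypothesis `C.card ≤ dq n + 1`;
no hypothesis on the rectangle is used. -/
theorem profileAttenuation_of_card_le :
    ∀ n : ℕ, ∀ (t : ℕ) (C : Finset ℕ) (w : ℕ → ℝ),
      IsBalancedDesign n t (Tq n) (dq n) 20 C w → C.card ≤ dq n + 1 → ∀ r : ℕ, 0 < r →
        ∀ (X : OddSet n → Matrix (Fin r) (Fin r) ℝ) (Y : PMatch n → Matrix (Fin r) (Fin r) ℝ),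
          ∃ p : Polynomial ℝ, p.natDegree ≤ dq n ∧
            (∀ c ∈ C, |levelProfile n t r X Y c - p.eval (c : ℝ)| ≤ (n : ℝ) ^ (-((dq n : ℝ) / 4))) ∧
            (∑ U, ∑ M, levelWeight n t C w U M * (X U * Y M).trace) / r ≤
              (∑ c ∈ C, w c * p.eval (c : ℝ)) + 20 * (n : ℝ) ^ (-((dq n : ℝ) / 4)) := by
  intro n t C w hdes hC r hr X Y
  have hpow : 0 ≤ (n : ℝ) ^ (-((dq n : ℝ) / 4)) := Real.rpow_nonneg (Nat.cast_nonneg n) _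
  refine ⟨Lagrange.interpolate C (fun c : ℕ => (c : ℝ)) (levelProfile n t r X Y), natDegree_interpolate_le_of_card _ hC, fun c hc => ?_, ?_⟩
  · rw [eval_interpolate_node _ hc, sub_self, abs_zero]; exact hpow
  · have heq : ∑ c ∈ C, w c * (Lagrange.interpolate C (fun c : ℕ => (c : ℝ)) (levelProfile n t r X Y)).eval (c : ℝ) =
        ∑ c ∈ C, w c * levelProfile n t r X Y c :=
      sum_congr rfl fun c hc => by rw [eval_interpolate_node (levelProfile n t r X Y) hc]
    rw [value_div_eq_sum_levelProfile hr, heq]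
    linarith

/-- **For designs with `≤ dq n + 1` nodes the crux is its virtual-level inequality**: the normalised tracial value of
any psd rectangle equals `−p_Φ(0)` for the degree-`≤ dq n` interpolant `p_Φ` of its level profile. -/
theorem value_div_eq_neg_interpolate_eval_zero {t : ℕ} {C : Finset ℕ} {w : ℕ → ℝ}
    (hdes : IsBalancedDesign n t (Tq n) (dq n) 20 C w) (hC : C.card ≤ dq n + 1) {r : ℕ} (hr : 0 < r)
    (X : OddSet n → Matrix (Fin r) (Fin r) ℝ) (Y : PMatch n → Matrix (Fin r) (Fin r) ℝ) :
    (∑ U, ∑ M, levelWeight n t C w U M * (X U * Y M).trace) / r =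
      -(Lagrange.interpolate C (fun c : ℕ => (c : ℝ)) (levelProfile n t r X Y)).eval 0 := by
  rw [value_div_eq_sum_levelProfile hr, design_sum_eq_neg_interpolate_eval_zero hdes.1 hC]

end Summit.PneNP.PneNP.Theorems.ChebyshevTracialDesignProfileInterpolation

end
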